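import Summits.CriticalPhenomena.PercolationContinuityZ3.Theorems.PercNearOneGluingNoHeavyQuantFarTreeMultiCompanion
import HarnessLib

/-!
# QUANT lane R8: FAR AT LAYER ONE ON EVERY TREE (route vocabulary), and the sharp `3/2` law

builds on p205010 (kernel theorem, internal audit signed; external expert review pending)

Support file (`--supports stmt-CriticalPhenomena-4575`), QUANT lane lead (gen 8), rung R8 of
`run/shared/lean/prim/quant/LADDER.md`; memo `prim-quant-lead-g7/LEAD-NOTES-G7.md` N17 (Corollaries (1), (2)).  Completes
`…QuantFarTreeLayerOne.lean` (p222132: the regime `t ≤ 1/2` / two reliable companions) using the multi-companion inequality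
`Quant.tree_twoReached_ge` (`…QuantFarTreeMultiCompanion.lean`) and the tree transfer `Quant.tree_relayCount_transfer` (p219638).
Theorems only; no sorries; standard axioms.

* `Quant.farRelayRow_tree_layerOne_of_sum` — tree-supported weights `w` on the pairs of `Fin n`, `o ∉ A`, `a ∈ A` a least likely relay
  (`P(o ↔ a) ≤ P(o ↔ x)` on `A`) with `Σ_{x ∈ A ∖ a} P(o ↔ x) ≥ 1`: `P(#{x ∈ A | o ↔ x} ≤ 1) ≤ P(o ↮ a)`.
* `Quant.farRelayRow_tree_layerOne` — **the `j = 1` instance of `Quant.FarRelayRow` (FAR) on EVERY tree-supported weight function, for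
  every `t`**: `2 < Σ_{a∈A} P(o ↔ a)` and `P(o ↮ a) ≤ t` on `A` imply `P(#{a ∈ A | o ↔ a} ≤ 1) ≤ t`.  (On general graphs the row is
  `Quant.FarRelayRow`, open; its layer 1 without the mean hypothesis is false from five vertices, `Quant.majorityRow_false_layerOne`.)
* `Quant.farRelayRow_tree_layerOne_threeHalves` — **the sharp layer-one law on trees**: `3 ≤ |A|`, `3/2 < Σ_{a∈A} P(o ↔ a)`, `P(o ↮ a) ≤ t`
  on `A` imply `P(#{a ∈ A | o ↔ a} ≤ 1) ≤ t` (least marginal `> 1/2`: two companions sum to `≥ 1`, p222132; else the others sum to `> 1`).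
  The constant `3/2` is the census threshold `θ(1)` (three relays of marginal `1/2` give equality; CENSUS-GAIN §14, V86/V97).
[cite: KozmaNitzan2024, Lemma 2 (p. 6), Conjecture 3 (p. 15)] (the gluing rows; FAR ⟹ the `j`-th row); [cite: Grimmett1999, §1.3 p. 10; §10.1]
(independent gates on a tree); the theorems [this work] (paper proof: lead g7, LEAD-NOTES-G7 N17; formalisation: lead g8).
-/

noncomputable section

namespace Summit.CriticalPhenomena.PercolationContinuityZ3.Theorems

namespace Quant

open Finset MeasureTheory
open Literature.Probability.LatticeModels
open Literature.Probability.Percolation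
open scoped Classical

/-! ### Gate coordinates: the reached-predicate form of the counting lemma -/

section Generic

variable {ι : Type*}

/-- `Quant.tree_card_le_one_le_of_sum` with the event written through the reached predicate
`y = o ∨ ∀ i ≤ depth y, par^[i] y ∈ ω'` of `Quant.tree_relayCount_transfer` (for non-root `y` this is "the chain of `y` is open").
[this work] -/
theorem tree_card_le_one_le_of_sum_reached (o : ι) (depth : ι → ℕ) (par : ι → ι)
    (hstep : ∀ x, x ≠ o → depth x ≠ 0 → par x ≠ o ∧ depth (par x) + 1 = depth x)
    [Finite ι] (q : ι → unitInterval) (R : Finset ι) (hoR : o ∉ R) {a : ι} (haR : a ∈ R)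
    (hmin : ∀ y ∈ R, ∏ i ∈ (Finset.range (depth a + 1)).image (fun i => par^[i] a), (q i : ℝ) ≤
      ∏ i ∈ (Finset.range (depth y + 1)).image (fun i => par^[i] y), (q i : ℝ))
    (hsum : 1 + ∏ i ∈ (Finset.range (depth a + 1)).image (fun i => par^[i] a), (q i : ℝ) ≤
      ∑ y ∈ R, ∏ i ∈ (Finset.range (depth y + 1)).image (fun i => par^[i] y), (q i : ℝ)) :
    (prodBernoulli q).real {ω' : Set ι | (R.filter fun y => y = o ∨ ∀ i, i ≤ depth y → par^[i] y ∈ ω').card ≤ 1} ≤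
      1 - ∏ i ∈ (Finset.range (depth a + 1)).image (fun i => par^[i] a), (q i : ℝ) := by
  have hsum' : 1 ≤ ∑ y ∈ R.erase a, ∏ i ∈ (Finset.range (depth y + 1)).image (fun i => par^[i] y), (q i : ℝ) := by
    have := Finset.sum_erase_add R
      (fun y => ∏ i ∈ (Finset.range (depth y + 1)).image (fun i => par^[i] y), (q i : ℝ)) haR
    linarith
  have h := tree_card_le_one_le_of_sum o depth par hstep q R hoR haR hmin hsum'
  have hRo : ∀ y ∈ R, y ≠ o := fun y hy h => hoR (h ▸ hy)
  have hevent : ∀ y, y ≠ o → ∀ ω' : Set ι, (y = o ∨ ∀ i, i ≤ depth y → par^[i] y ∈ ω') ↔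
      (((Finset.range (depth y + 1)).image (fun i => par^[i] y) : Finset ι) : Set ι) ⊆ ω' := by
    intro y hyo ω'
    simp only [hyo, false_or, Finset.coe_image, Finset.coe_range, Set.image_subset_iff]
    constructor
    · intro h i hi
      exact h i (by simpa [Nat.lt_succ_iff] using hi)
    · intro h i hi
      exact h (show i ∈ Set.Iio (depth y + 1) by simpa [Nat.lt_succ_iff] using hi)
  have hset : {ω' : Set ι | (R.filter fun y => y = o ∨ ∀ i, i ≤ depth y → par^[i] y ∈ ω').card ≤ 1} =
      {ω' : Set ι | (R.filter fun y =>
        (((Finset.range (depth y + 1)).image (fun i => par^[i] y) : Finset ι) : Set ι) ⊆ ω').card ≤ 1} := by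
    ext ω'
    simp only [Set.mem_setOf_eq]
    rw [Finset.filter_congr fun y hy => hevent y (hRo y hy) ω']
  rw [hset]
  exact h

end Generic

/-! ### Route vocabulary -/

/-- **Layer one with a least likely relay and companions summing to `≥ 1` (route vocabulary).**  Tree-supported `w` on the pairs of `Fin n`
(every nonzero-weight pair a loop or a parent pair), `o ∉ A`, `a ∈ A` with `P(o ↔ a) ≤ P(o ↔ x)` for all `x ∈ A` and
`1 ≤ Σ_{x ∈ A ∖ a} P(o ↔ x)`.  Then `P(#{x ∈ A | o ↔ x} ≤ 1) ≤ P(o ↮ a)`. [this work] -/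
theorem farRelayRow_tree_layerOne_of_sum (n : ℕ) (w : Sym2 (Fin n) → unitInterval) (o : Fin n) (depth : Fin n → ℕ)
    (par : Fin n → Fin n)
    (hroot : ∀ x, x ≠ o → depth x = 0 → par x = o)
    (hstep : ∀ x, x ≠ o → depth x ≠ 0 → par x ≠ o ∧ depth (par x) + 1 = depth x)
    (hsupp : ∀ e, w e ≠ 0 → e.IsDiag ∨ ∃ x, x ≠ o ∧ e = s(par x, x))
    (A : Finset (Fin n)) (hoA : o ∉ A) {a : Fin n} (haA : a ∈ A)
    (hmin : ∀ x ∈ A, (prodBernoulli w).real (openConn o a) ≤ (prodBernoulli w).real (openConn o x))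
    (hsum : 1 ≤ ∑ x ∈ A.erase a, (prodBernoulli w).real (openConn o x)) :
    (prodBernoulli w).real {ω : BondConfig (Fin n) | (A.filter fun x => ω ∈ openConn o x).card ≤ 1} ≤
      (prodBernoulli w).real (openConn o a : Set (BondConfig (Fin n)))ᶜ := by
  have hmeasB : ∀ S : Set (BondConfig (Fin n)), MeasurableSet S := fun S => (Set.toFinite S).measurableSet
  set q : Fin n → unitInterval := fun x => if x = o then 1 else w s(par x, x) with hq
  have hq' : ∀ x, x ≠ o → q x = w s(par x, x) := fun x hx => by simp [hq, hx]
  have hAo : ∀ x ∈ A, x ≠ o := fun x hx h => hoA (h ▸ hx)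
  -- marginals in gate coordinates (the product over the ancestral chain, classical instances as in the generic files)
  have hmarg := fun (x : Fin n) (hx : x ≠ o) =>
    (tree_real_openConn_eq_prod n w o depth par hroot hstep hsupp x hx).trans (tree_prod_anc_eq w q o depth par hstep hq' x hx).symm
  rw [probReal_compl_eq_one_sub (hmeasB _), tree_relayCount_transfer n w o depth par hroot hstep hsupp A 1, hmarg a (hAo a haA)]
  have hsum' : 1 + (prodBernoulli w).real (openConn o a) ≤ ∑ x ∈ A, (prodBernoulli w).real (openConn o x) := by
    have := Finset.sum_erase_add A (fun x => (prodBernoulli w).real (openConn o x : Set (BondConfig (Fin n)))) haA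
    linarith
  rw [hmarg a (hAo a haA), Finset.sum_congr rfl fun x hx => hmarg x (hAo x hx)] at hsum'
  have h := tree_card_le_one_le_of_sum_reached o depth par hstep q A hoA haA (fun x hx => by
    have := hmin x hx
    rw [hmarg a (hAo a haA), hmarg x (hAo x hx)] at this
    exact this) hsum'
  -- the generic lemma carries the classical `DecidablePred` for the filter; `convert` bridges the instances
  convert h using 7

/-- **FAR AT LAYER ONE ON EVERY TREE** — the `j = 1` instance of `Quant.FarRelayRow` for every tree-supported weight function and every
`t`: `2 < Σ_{a∈A} P(o ↔ a)` and `P(o ↮ a) ≤ t` for all `a ∈ A` imply `P(#{a ∈ A | o ↔ a} ≤ 1) ≤ t`.  Proof: `|A| ≥ 3`; if `o ∈ A`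
the event forces a second relay to be missed; else take `a` least likely: the others sum to `> 2 − P(o ↔ a) ≥ 1` and
`farRelayRow_tree_layerOne_of_sum` (the multi-companion inequality) applies. [this work] -/
theorem farRelayRow_tree_layerOne (n : ℕ) (w : Sym2 (Fin n) → unitInterval) (o : Fin n) (depth : Fin n → ℕ)
    (par : Fin n → Fin n)
    (hroot : ∀ x, x ≠ o → depth x = 0 → par x = o)
    (hstep : ∀ x, x ≠ o → depth x ≠ 0 → par x ≠ o ∧ depth (par x) + 1 = depth x)
    (hsupp : ∀ e, w e ≠ 0 → e.IsDiag ∨ ∃ x, x ≠ o ∧ e = s(par x, x))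
    (A : Finset (Fin n)) (t : ℝ)
    (hEN : (2 : ℝ) < ∑ a ∈ A, (prodBernoulli w).real (openConn o a))
    (hcut : ∀ a ∈ A, (prodBernoulli w).real (openConn o a : Set (BondConfig (Fin n)))ᶜ ≤ t) :
    (prodBernoulli w).real {ω : BondConfig (Fin n) | (A.filter fun x => ω ∈ openConn o x).card ≤ 1} ≤ t := by
  set μ := prodBernoulli w with hμ
  have hmeasB : ∀ S : Set (BondConfig (Fin n)), MeasurableSet S := fun S => (Set.toFinite S).measurableSet
  -- `|A| ≥ 3`
  have hcard : 2 < A.card := by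
    have h1 : ∑ a ∈ A, μ.real (openConn o a : Set (BondConfig (Fin n))) ≤ ∑ a ∈ A, (1 : ℝ) :=
      Finset.sum_le_sum fun a _ => measureReal_le_one
    rw [Finset.sum_const, nsmul_eq_mul, mul_one] at h1
    exact_mod_cast (lt_of_lt_of_le hEN h1)
  by_cases hoA : o ∈ A
  · -- pick `b ∈ A`, `b ≠ o`: `N ≤ 1` forces `o ↮ b` because `o ↔ o` always
    have hcard' : 0 < (A.erase o).card := by rw [Finset.card_erase_of_mem hoA]; omega
    obtain ⟨b, hb⟩ := Finset.card_pos.1 hcard'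
    have hbo : b ≠ o := (Finset.mem_erase.1 hb).1
    have hbA : b ∈ A := (Finset.mem_erase.1 hb).2
    have hsub : {ω : BondConfig (Fin n) | (A.filter fun x => ω ∈ openConn o x).card ≤ 1} ⊆
        (openConn o b : Set (BondConfig (Fin n)))ᶜ := by
      intro ω hω hωb
      have hω1 : (A.filter fun x => ω ∈ openConn o x).card ≤ 1 := hω
      have h2 : ({o, b} : Finset (Fin n)) ⊆ A.filter fun x => ω ∈ openConn o x := by
        intro x hx
        rw [Finset.mem_insert, Finset.mem_singleton] at hx
        rw [Finset.mem_filter]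
        rcases hx with rfl | rfl
        · exact ⟨hoA, SimpleGraph.Reachable.refl _⟩
        · exact ⟨hbA, hωb⟩
      have := Finset.card_le_card h2
      rw [Finset.card_pair hbo.symm] at this
      omega
    exact le_trans (measureReal_mono hsub (measure_ne_top _ _)) (hcut b hbA)
  · -- `o ∉ A`: the least likely relay; the others sum to at least one
    have hne : A.Nonempty := Finset.card_pos.1 (by omega)
    obtain ⟨a, haA, hmin⟩ := Finset.exists_min_image A (fun x => μ.real (openConn o x : Set (BondConfig (Fin n)))) hne
    have ha1 : μ.real (openConn o a : Set (BondConfig (Fin n))) ≤ 1 := measureReal_le_one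
    have hsum : 1 ≤ ∑ x ∈ A.erase a, μ.real (openConn o x : Set (BondConfig (Fin n))) := by
      have := Finset.sum_erase_add A (fun x => μ.real (openConn o x : Set (BondConfig (Fin n)))) haA
      linarith
    exact le_trans (farRelayRow_tree_layerOne_of_sum n w o depth par hroot hstep hsupp A hoA haA hmin hsum) (hcut a haA)

/-- **The sharp layer-one law on trees (`3/2` law).**  Tree-supported `w`; `3 ≤ |A|`, `3/2 < Σ_{a∈A} P(o ↔ a)` and `P(o ↮ a) ≤ t` for all
`a ∈ A` imply `P(#{a ∈ A | o ↔ a} ≤ 1) ≤ t`.  If the least marginal exceeds `1/2`, any two companions sum to `≥ 1`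
(`farRelayRow_tree_layerOne_of_companions`, p222132); otherwise the companions of the least likely relay sum to `> 3/2 − 1/2 = 1`
(`farRelayRow_tree_layerOne_of_sum`).  Three relays of marginal `1/2` show that `3/2` cannot be lowered. [this work] -/
theorem farRelayRow_tree_layerOne_threeHalves (n : ℕ) (w : Sym2 (Fin n) → unitInterval) (o : Fin n) (depth : Fin n → ℕ)
    (par : Fin n → Fin n)
    (hroot : ∀ x, x ≠ o → depth x = 0 → par x = o)
    (hstep : ∀ x, x ≠ o → depth x ≠ 0 → par x ≠ o ∧ depth (par x) + 1 = depth x)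
    (hsupp : ∀ e, w e ≠ 0 → e.IsDiag ∨ ∃ x, x ≠ o ∧ e = s(par x, x))
    (A : Finset (Fin n)) (t : ℝ) (hcardA : 3 ≤ A.card)
    (hEN : (3 / 2 : ℝ) < ∑ a ∈ A, (prodBernoulli w).real (openConn o a))
    (hcut : ∀ a ∈ A, (prodBernoulli w).real (openConn o a : Set (BondConfig (Fin n)))ᶜ ≤ t) :
    (prodBernoulli w).real {ω : BondConfig (Fin n) | (A.filter fun x => ω ∈ openConn o x).card ≤ 1} ≤ t := by
  set μ := prodBernoulli w with hμ
  have hmeasB : ∀ S : Set (BondConfig (Fin n)), MeasurableSet S := fun S => (Set.toFinite S).measurableSet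
  by_cases hoA : o ∈ A
  · have hcard' : 0 < (A.erase o).card := by rw [Finset.card_erase_of_mem hoA]; omega
    obtain ⟨b, hb⟩ := Finset.card_pos.1 hcard'
    have hbo : b ≠ o := (Finset.mem_erase.1 hb).1
    have hbA : b ∈ A := (Finset.mem_erase.1 hb).2
    have hsub : {ω : BondConfig (Fin n) | (A.filter fun x => ω ∈ openConn o x).card ≤ 1} ⊆
        (openConn o b : Set (BondConfig (Fin n)))ᶜ := by
      intro ω hω hωb
      have hω1 : (A.filter fun x => ω ∈ openConn o x).card ≤ 1 := hω
      have h2 : ({o, b} : Finset (Fin n)) ⊆ A.filter fun x => ω ∈ openConn o x := by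
        intro x hx
        rw [Finset.mem_insert, Finset.mem_singleton] at hx
        rw [Finset.mem_filter]
        rcases hx with rfl | rfl
        · exact ⟨hoA, SimpleGraph.Reachable.refl _⟩
        · exact ⟨hbA, hωb⟩
      have := Finset.card_le_card h2
      rw [Finset.card_pair hbo.symm] at this
      omega
    exact le_trans (measureReal_mono hsub (measure_ne_top _ _)) (hcut b hbA)
  · have hne : A.Nonempty := Finset.card_pos.1 (by omega)
    obtain ⟨a, haA, hmin⟩ := Finset.exists_min_image A (fun x => μ.real (openConn o x : Set (BondConfig (Fin n)))) hne
    have hao : a ≠ o := fun h => hoA (h ▸ haA)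
    by_cases hhalf : 1 / 2 < μ.real (openConn o a : Set (BondConfig (Fin n)))
    · -- two companions with marginals `> 1/2`
      have hcard' : 1 < (A.erase a).card := by rw [Finset.card_erase_of_mem haA]; omega
      obtain ⟨b, hb, c, hc, hbc⟩ := Finset.one_lt_card.1 hcard'
      have hba : b ≠ a := (Finset.mem_erase.1 hb).1
      have hbA : b ∈ A := (Finset.mem_erase.1 hb).2
      have hca : c ≠ a := (Finset.mem_erase.1 hc).1
      have hcA : c ∈ A := (Finset.mem_erase.1 hc).2
      have hbo : b ≠ o := fun h => hoA (h ▸ hbA)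
      have hco : c ≠ o := fun h => hoA (h ▸ hcA)
      have h := farRelayRow_tree_layerOne_of_companions n w o depth par hroot hstep hsupp A haA hbA hcA hao hbo hco
        hba.symm hca.symm hbc (hmin b hbA) (hmin c hcA) (by linarith [hmin b hbA, hmin c hcA])
      exact le_trans h (hcut a haA)
    · push Not at hhalf
      have hsum : 1 ≤ ∑ x ∈ A.erase a, μ.real (openConn o x : Set (BondConfig (Fin n))) := by
        have := Finset.sum_erase_add A (fun x => μ.real (openConn o x : Set (BondConfig (Fin n)))) haA
        linarith
      exact le_trans (farRelayRow_tree_layerOne_of_sum n w o depth par hroot hstep hsupp A hoA haA hmin hsum) (hcut a haA)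

end Quant

end Summit.CriticalPhenomena.PercolationContinuityZ3.Theorems

end
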